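/-
COR-CM (cell pub-hodgecm2, stage 2 of the Hodge ladder) — Δ2 BRIDGE, WALL-BREAKER 4 (seat `prover-pub-hodgecm2-d2bridge-wb-4-g0-0`), 2026-08-23:
**THE (d) PIECES BY VALUE AT THE INSTANCE `ῑ₁ = conj ∘ ι₁`, COMPOSED FROM TREE TERMS** — prove-5's J2 interface TERM with its level law
(✔ `ComponentAlbanesePinLaw`: `componentAlbanesePinTotal`, `componentAlbanesePinTotal_levelLaw`), prove-2's proof-objects record at the pin
(✔ `Map43RecordAtPin`: `map43RecordAtPin`, `jHPin`) and prove-3's orientation-generic pieces (✔ `HcmPiecesAtPin`: `nonempty_hcmPieces_atUniformRest`,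
`nonempty_hcmPieces_atLiuDictionaryPin`) — in the two shapes the cell's two tracks consume: (ADAPTER, GAP-READ-2 (c-S.2)) the LITERAL pin
`liuDictionaryPin … V I line`, served character `ν` of CONJUGATE type `Φ_ν = Φ̄(typeOfLine (line i))` (e.g. `ν := μ_iᶜ`), instance `ῑ₁ ∈ Φ_ν`;
(RE-KEY, (c-S.1)) the tower dictionary keyed at `ῑ₁` (`PhiMuLine ῑ₁`, `IsReflexOfTypeG ῑ₁`), SAME character `μ` with `Φ_μ = typeOfLine (line i)`.
THEOREMS ONLY (kernel lane): no definition, no instance, no named fact, no `sorry`; explicit per-theorem binders.  FRAMING: HC_CM is NOT proved;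
«Δ2 BRIDGE CLOSED» is NOT claimed; which dictionary ∕ which display the END adopts is the ASSEMBLER's ∕ referees' decision, not this file's.
-/
import Summits.HodgeConjecture.CorCM.D2Bridge.ComponentAlbanesePinLaw
import Summits.HodgeConjecture.CorCM.D2Bridge.HcmPiecesAtPin
import Summits.HodgeConjecture.CorCM.D2Bridge.ReflexOfTypeConj
import HarnessLib

set_option autoImplicit false

/-!
# Δ2 bridge — the (d) pieces BY VALUE at instance `ῑ₁`, from tree terms (wb-4 integration)

* `comp_cmConjRingHom_eq_of_starRingEnd` — at the instance `ῑ₁.toAlgebra`, `algebraMap ∘ c = ι₁` (prove-5's `hι`).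
* `adapter_pieces_byValue` — `Nonempty (HcmPieces (toThm418Data C (U.rest (restTailOne id ῑ₁ hν hwν Carν (HT.rhoΩOne id ῑ₁ …))))
  (map43RecordAtPin (componentAlbanesePinTotal …) id ῑ₁ … Dν τ' hτ') (liuDictionaryPin …).H (jHPin …) K.K (CohC (pms L ι₁ V K) 1) (resTotal K)
  ((liuDictionaryPin …).cmClasses K i))` for `K ≤ capThree K₀` under `hsign : Φ_ν = Φ̄(typeOfLine (line i))` — the adapter's (d) slot at the
  literal key (admissibility transfer: ✔ `isReflexOfTypeG_conj_iff` + `bar_bar`, [Liu2021] Rem. 4.4).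
* `rekey_pieces_byValue` — the same at the tower dictionary keyed at `ῑ₁`, for `μ` with `hmirror : Φ_μ = typeOfLine (line i)`.

References: Y. Liu, arXiv:2102.11518 = Camb. J. Math. 9 (2021): Thm. 4.18 (1) and its proof map (4.2)∕(4.3) (l. 2247–2253), Rem. 4.17,
Lem. 2.4 (1), Def. 4.5 (2), Def. 4.3 (2), Rem. 4.4; G. Shimura, *Abelian Varieties with CM* (1998) §8.3 Prop. 28.  HC_CM is NOT proved.
-/

noncomputable section

namespace Summit.HodgeConjecture.CorCM.D2Bridge.PiecesByValueConj

open CategoryTheory NumberField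
open Literature.AlgebraicGeometry.Motives (CMType)
open Literature.AlgebraicGeometry.HodgeTheory
open Literature.AlgebraicGeometry.ShimuraVarieties.UnitaryCanonicalModel
open Literature.NumberTheory.Automorphic Literature.NumberTheory.Automorphic.PicardCM
open Literature.NumberTheory.Automorphic.Liu2021 Literature.NumberTheory.Automorphic.Liu2021.AppendixC
open Literature.NumberTheory.Automorphic.Liu2021.AppendixC.RestOne
open Literature.NumberTheory.Transcendental (Arapura2012_Cor_15_4_6)
open Summit.HodgeConjecture.CorCM.HComp
open HodgeCM.Model HodgeCM.Model.LevelTranslate HodgeCM.Model.TowerLevel HodgeCM.Model.TowerCarrier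
open HodgeCM.Literature.Theta.LiuAlbaneseModuleDatum.D2Bridge (HcmPieces)
open Summit.HodgeConjecture.CorCM.D2Bridge

variable {L : HodgeCM.CMField} {ι₁ : L →+* ℂ}

/-- `algebraMap ∘ c = ι₁` at the instance `ῑ₁ := conj ∘ ι₁` (prove-5's `hι`: every complex embedding intertwines `c` with conjugation). [folklore] -/
theorem comp_cmConjRingHom_eq_of_starRingEnd :
    letI := ((starRingEnd ℂ).comp ι₁).toAlgebra
    (algebraMap L ℂ).comp (cmConjRingHom L) = ι₁ := by
  letI := ((starRingEnd ℂ).comp ι₁).toAlgebra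
  refine RingHom.ext fun x => ?_
  show starRingEnd ℂ (ι₁ (cmConjRingHom L x)) = ι₁ x
  rw [embedding_cmConjRingHom, starRingEnd_self_apply]

set_option synthInstance.maxHeartbeats 400000 in
set_option maxHeartbeats 3200000 in
/-- **ADAPTER (c)(d) BY VALUE at the LITERAL pin, instance `ῑ₁`, served character `ν` with `Φ_ν = Φ̄(typeOfLine (line i))`:**
`J := componentAlbanesePinTotal …`, `M := map43RecordAtPin J id ῑ₁ …`, `jH := jHPin …`, pieces := prove-3's `nonempty_hcmPieces_atLiuDictionaryPin`
with `hΓ := componentAlbanesePinTotal_levelLaw` and `hadmμ` discharged by `isReflexOfTypeG_conj_iff` + `hsign` + `bar_bar`.  HC_CM is NOT proved.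
[cite: Liu2021, Thm. 4.18 (1) (FJcycle.tex l. 2239), proof of Thm. 4.18 (l. 2247–2253), Remark 4.4 (l. 1930–1933), Def. 4.3 (2), Def. 4.5 (2)] [cite: Shimura1998, §8.3 Prop. 28] -/
theorem adapter_pieces_byValue {hHD : exists_isReal_hodgeModel} {hI : hodgePQ_independent_of_hodgeModel}
    {h₁ : BallQuotientUniformised} {h₃ : CMAbelianVarietyRealised} {hA : Arapura2012_Cor_15_4_6}
    [IsGalois ℚ (L : Type)] (hU7 : heckeTranslate_definedOver) (V : HodgeCM.HermSpace3 L ι₁) (h : exists_recordSystem)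
    (h4 : 4 ≤ Module.finrank ℚ L) (Φ : CMType (pkgF L))
    (iso : ∀ (F : Summit.HodgeConjecture.CorCM.CMField) (ι : F →+* ℂ) (_ : Summit.HodgeConjecture.CorCM.HermSpace3 F ι)
      (_ : CMType F), ℕ → Prop)
    (U : UniformOmega (Model.sec42DataOf h iso (pkgF L) ι₁ (pkgV V) Φ))
    {ν : Literature.NumberTheory.Automorphic.IdeleClassGroup L →ₜ* Circle} (hν : IdeleClassGroup.IsConjugateSymplectic (L : Type) ν)
    (hwν : IdeleClassGroup.HasWeight (L : Type) ν 1) (Carν : Def45.Carriers (L : Type) ν)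
    (Dν : ObjOne (AlgHom.id ℚ (L : Type)) ((starRingEnd ℂ).comp ι₁) hν hwν Carν) (τ' : L →+* ℂ) (hτ' : τ' ∈ hν.cmType.1)
    (I : Type) (line : I → HodgeCM.Model.SplitLineE V) (i : I) (K : HodgeCM.Level V)
    (hK : K ≤ HodgeCM.Level.capThree (V := V) ((Model.sec42DataOf h iso (pkgF L) ι₁ (pkgV V) Φ).S.K₀.1 : Subgroup ↥V.adelicFin)
      (Model.sec42DataOf h iso (pkgF L) ι₁ (pkgV V) Φ).S.K₀.2.1)
    (hsign : hν.cmType = HodgeCM.CMTypeOps.bar (HodgeCM.Model.SplitLine.typeOfLine (line i))) :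
    letI := ((starRingEnd ℂ).comp ι₁).toAlgebra
    Nonempty (HcmPieces.{0, 1, 0}
      (toThm418Data _ (U.rest (restTailOne (AlgHom.id ℚ (L : Type)) ((starRingEnd ℂ).comp ι₁) hν hwν Carν
        ((Model.sec42DataOf_heckeTranslates hU7 h (pkgV V) Φ iso h4).rhoΩOne (AlgHom.id ℚ (L : Type)) ((starRingEnd ℂ).comp ι₁) hν hwν Carν))))
      (map43RecordAtPin (componentAlbanesePinTotal hHD hI (ballQuotientUniformisedDatum_of h₁) h₃ hA hU7 V h h4
          (comp_cmConjRingHom_eq_of_starRingEnd (ι₁ := ι₁)) Φ iso)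
        (AlgHom.id ℚ (L : Type)) ((starRingEnd ℂ).comp ι₁) hν hwν Carν U.Eps U.epsOf U.Chi (U.omega ν hν) (U.rho ν hν) Dν τ' hτ')
      (HodgeCM.Model.liuDictionaryPin hHD hI h₁ h₃ hA V I line).H
      (jHPin (componentAlbanesePinTotal hHD hI (ballQuotientUniformisedDatum_of h₁) h₃ hA hU7 V h h4
          (comp_cmConjRingHom_eq_of_starRingEnd (ι₁ := ι₁)) Φ iso)
        (AlgHom.id ℚ (L : Type)) ((starRingEnd ℂ).comp ι₁) hν hwν Carν U.Eps U.epsOf U.Chi (U.omega ν hν) (U.rho ν hν) Dν τ' hτ') K.K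
      ((HodgeCM.Model.picardCMUniverse hHD hI h₁ h₃).CohC ((HodgeCM.Model.picardCMUniverse hHD hI h₁ h₃).pms L ι₁ V K) 1)
      (resTotal hHD hI (ballQuotientUniformisedDatum_of h₁) h₃ hA K)
      ((HodgeCM.Model.liuDictionaryPin hHD hI h₁ h₃ hA V I line).cmClasses K i)) := by
  letI := ((starRingEnd ℂ).comp ι₁).toAlgebra
  exact nonempty_hcmPieces_atLiuDictionaryPin hν hwν Carν ((starRingEnd ℂ).comp ι₁) (fun _ => rfl) I line U
    (componentAlbanesePinTotal hHD hI (ballQuotientUniformisedDatum_of h₁) h₃ hA hU7 V h h4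
      (comp_cmConjRingHom_eq_of_starRingEnd (ι₁ := ι₁)) Φ iso)
    (componentAlbanesePinTotal_levelLaw hHD hI (ballQuotientUniformisedDatum_of h₁) h₃ hA hU7 V h h4
      (comp_cmConjRingHom_eq_of_starRingEnd (ι₁ := ι₁)) Φ iso)
    Dν τ' hτ' i K hK fun d hd => by
      have h' := (isReflexOfTypeG_conj_iff ι₁ d hν.cmType).mp hd
      rw [hsign, HodgeCM.CMTypeOps.bar_bar] at h'
      exact h'

set_option synthInstance.maxHeartbeats 400000 in
set_option maxHeartbeats 3200000 in
/-- **RE-KEY (c)(d) BY VALUE at the RE-KEYED tower dictionary (`PhiMu′ ∕ adm′` at `ῑ₁`), instance `ῑ₁`, SAME character `μ` with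
`Φ_μ = typeOfLine (line i)` (MIRROR):** same terms, `hadmμ := hmirror ▸ ·`.  HC_CM is NOT proved.
[cite: Liu2021, Thm. 4.18 (1) (FJcycle.tex l. 2239), proof of Thm. 4.18 (l. 2247–2253), Def. 4.3 (2), Def. 4.5 (2)] -/
theorem rekey_pieces_byValue {hHD : exists_isReal_hodgeModel} {hI : hodgePQ_independent_of_hodgeModel}
    {h₁ : BallQuotientUniformised} {h₃ : CMAbelianVarietyRealised} {hA : Arapura2012_Cor_15_4_6}
    [IsGalois ℚ (L : Type)] (hU7 : heckeTranslate_definedOver) (V : HodgeCM.HermSpace3 L ι₁) (h : exists_recordSystem)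
    (h4 : 4 ≤ Module.finrank ℚ L) (Φ : CMType (pkgF L))
    (iso : ∀ (F : Summit.HodgeConjecture.CorCM.CMField) (ι : F →+* ℂ) (_ : Summit.HodgeConjecture.CorCM.HermSpace3 F ι)
      (_ : CMType F), ℕ → Prop)
    (U : UniformOmega (Model.sec42DataOf h iso (pkgF L) ι₁ (pkgV V) Φ))
    {μ : Literature.NumberTheory.Automorphic.IdeleClassGroup L →ₜ* Circle} (hμ : IdeleClassGroup.IsConjugateSymplectic (L : Type) μ)
    (hw : IdeleClassGroup.HasWeight (L : Type) μ 1) (Car : Def45.Carriers (L : Type) μ)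
    (Dμ : ObjOne (AlgHom.id ℚ (L : Type)) ((starRingEnd ℂ).comp ι₁) hμ hw Car) (τ' : L →+* ℂ) (hτ' : τ' ∈ hμ.cmType.1)
    (I : Type) (line : I → HodgeCM.Model.SplitLineE V) (i : I) (K : HodgeCM.Level V)
    (hK : K ≤ HodgeCM.Level.capThree (V := V) ((Model.sec42DataOf h iso (pkgF L) ι₁ (pkgV V) Φ).S.K₀.1 : Subgroup ↥V.adelicFin)
      (Model.sec42DataOf h iso (pkgF L) ι₁ (pkgV V) Φ).S.K₀.2.1)
    (hmirror : hμ.cmType = HodgeCM.Model.SplitLine.typeOfLine (line i)) :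
    letI := ((starRingEnd ℂ).comp ι₁).toAlgebra
    Nonempty (HcmPieces.{0, 1, 0}
      (toThm418Data _ (U.rest (restTailOne (AlgHom.id ℚ (L : Type)) ((starRingEnd ℂ).comp ι₁) hμ hw Car
        ((Model.sec42DataOf_heckeTranslates hU7 h (pkgV V) Φ iso h4).rhoΩOne (AlgHom.id ℚ (L : Type)) ((starRingEnd ℂ).comp ι₁) hμ hw Car))))
      (map43RecordAtPin (componentAlbanesePinTotal hHD hI (ballQuotientUniformisedDatum_of h₁) h₃ hA hU7 V h h4
          (comp_cmConjRingHom_eq_of_starRingEnd (ι₁ := ι₁)) Φ iso)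
        (AlgHom.id ℚ (L : Type)) ((starRingEnd ℂ).comp ι₁) hμ hw Car U.Eps U.epsOf U.Chi (U.omega μ hμ) (U.rho μ hμ) Dμ τ' hτ')
      (LiuDictionary.ofTower hHD hI h₁ h₃ hA V I (fun i => {χ : (line i).CharW // (line i).IsAutChar χ})
        (fun i a => (line i).Ω (HodgeCM.Model.ιVE V) a.1) (fun i => HodgeCM.Model.SplitLine.PhiMuLine ((starRingEnd ℂ).comp ι₁) (line i))
        (fun i dd => dd.IsReflexOfTypeG ((starRingEnd ℂ).comp ι₁) (HodgeCM.Model.SplitLine.typeOfLine (line i)))).H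
      (jHPin (componentAlbanesePinTotal hHD hI (ballQuotientUniformisedDatum_of h₁) h₃ hA hU7 V h h4
          (comp_cmConjRingHom_eq_of_starRingEnd (ι₁ := ι₁)) Φ iso)
        (AlgHom.id ℚ (L : Type)) ((starRingEnd ℂ).comp ι₁) hμ hw Car U.Eps U.epsOf U.Chi (U.omega μ hμ) (U.rho μ hμ) Dμ τ' hτ') K.K
      ((HodgeCM.Model.picardCMUniverse hHD hI h₁ h₃).CohC ((HodgeCM.Model.picardCMUniverse hHD hI h₁ h₃).pms L ι₁ V K) 1)
      (resTotal hHD hI (ballQuotientUniformisedDatum_of h₁) h₃ hA K)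
      ((LiuDictionary.ofTower hHD hI h₁ h₃ hA V I (fun i => {χ : (line i).CharW // (line i).IsAutChar χ})
        (fun i a => (line i).Ω (HodgeCM.Model.ιVE V) a.1) (fun i => HodgeCM.Model.SplitLine.PhiMuLine ((starRingEnd ℂ).comp ι₁) (line i))
        (fun i dd => dd.IsReflexOfTypeG ((starRingEnd ℂ).comp ι₁) (HodgeCM.Model.SplitLine.typeOfLine (line i)))).cmClasses K i)) := by
  letI := ((starRingEnd ℂ).comp ι₁).toAlgebra
  exact nonempty_hcmPieces_atUniformRest I (fun i => {χ : (line i).CharW // (line i).IsAutChar χ})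
    (fun i a => (line i).Ω (HodgeCM.Model.ιVE V) a.1) (fun i => HodgeCM.Model.SplitLine.PhiMuLine ((starRingEnd ℂ).comp ι₁) (line i))
    (fun i dd => dd.IsReflexOfTypeG ((starRingEnd ℂ).comp ι₁) (HodgeCM.Model.SplitLine.typeOfLine (line i))) hμ hw Car
    ((starRingEnd ℂ).comp ι₁) (fun _ => rfl) U
    (componentAlbanesePinTotal hHD hI (ballQuotientUniformisedDatum_of h₁) h₃ hA hU7 V h h4
      (comp_cmConjRingHom_eq_of_starRingEnd (ι₁ := ι₁)) Φ iso)
    (componentAlbanesePinTotal_levelLaw hHD hI (ballQuotientUniformisedDatum_of h₁) h₃ hA hU7 V h h4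
      (comp_cmConjRingHom_eq_of_starRingEnd (ι₁ := ι₁)) Φ iso)
    Dμ τ' hτ' i K hK (fun d hd => hmirror ▸ hd)

end Summit.HodgeConjecture.CorCM.D2Bridge.PiecesByValueConj

end
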